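import Literature.MathematicalPhysics.QuantumFieldTheory.Balaban1983to89.B13Lemma3TorusTerms

/-!
# `Balaban1983to89.B13Lemma3TorusSocket` — T. Bałaban, *Renormalization group approach to lattice gauge field
theories. II. Cluster expansions*, Commun. Math. Phys. **116** (1988) 1–22 [Balaban1988RG2Cluster]: the (2.38)_ℓ
FAMILY SOCKET `∀ n, B13.Bound238With (W n).toStepData c ℓ` of the β-remainder chain (`Beta.RemainderLocalityHolo.
PolLeavesTFac190H.h238`, binder (D4) of B12 Thm 2's perturbative road) JOINED BY NAME to the kernel-checked torus
chain `B13Lemma3Torus.bound238With_torus` ⇐ `B13Lemma3TorusTerms.hrep_of_termwise` ⇐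
`B13Lemma3TorusPrimitive.h226_torus_of_primitives` (Literature twin of the pub-balaban-gaps cell's typed target #3
`Gaps/D4NodeALemma3Joiner`, drafted by planner seat g1-plan-1, v1 2026-08-22; filed unchanged by prover seat g1-p2 gen 2
per the cell lead's ruling R9)

statement-level skeleton of published theorems with citation tags; proofs where landed; nothing here is a claim about the Yang–Mills mass gap


HONEST FRAMING.  This file is BOOKKEEPING: it names, as Lean `Prop`s, the two levels at which the (D4) leaf's Lemma-3
field `h238 : ∀ n, B13.Bound238With (W n).toStepData c ℓ` (`Beta.RemainderLocalityHolo.PolLeavesTFac190H.h238`; «NODE A»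
of the pub-balaban-gaps plan `G1-PLAN-D4` §2) is ALREADY a theorem of the tree for the papers' periodic carrier, and proves the
joins.  It asserts NOTHING of Bałaban's beyond print; every printed estimate is a NAMED HYPOTHESIS; no `sorry`, no
axiom; nothing here is (D4) discharged (the INSTANCE — Bałaban's step objects as a `TwoTorusStep` family — is not in the
tree: 0∕1); NOT B12 Thm 2, NOT `BetaPertH`, NOT continuum∕ℝ⁴, NOT Clay.

THE TWO LEVELS (tree names; LIT = `Literature/MathematicalPhysics/QuantumFieldTheory/Balaban1983to89/`):
* LEVEL R ("resummed (2.26)", `HRep` below = hypothesis `hrep` of `B13Lemma3Torus.bound238With_torus` :333):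
  `h238_of_hRep` — for a family of two-torus steps `W₂ n : TwoTorusStep 4 L (N′ n)`, `HRep` at every n + the (2.36)_ℓ
  transfer `B13.Ineq236With` + ONE n- and k-UNIFORM bundle of the printed restrictions on the constants
  (`Lemma3Numerics`) ⟹ `∀ n, B13.Bound238With ((W₂ n).toTorusStep).toStepData c ℓ`, which IS the socket field for
  `W := fun n => (W₂ n).toTorusStep` (`socket_iff`, `Iff.rfl`).  At the printed ℓ = ½L (L ≥ 8) the transfer hypothesis
  is the tree theorem `TreeLengthTorusGeometry236Printed.ineq236Printed_torus` (`h238_of_hRep_half`).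
* LEVEL T ("(2.26) per term", `TermDomination` + `Termwise226` below = hypotheses `hH`, `h226` of
  `B13Lemma3TorusTerms.hrep_of_termwise` :934): `hRep_of_termwise`, `h238_of_termwise`.
* BELOW LEVEL T the tree continues (NOT re-bound here, 60+ binders): `B13Lemma3TorusPrimitive.h226_torus_of_primitives`
  :195 gives `Termwise226` for ONE term realized as the generic display (2.14)
  (`B13Term214.term214 r lZ lD (core214 A Γ (F214 |P| χY₀ χcP 𝐃 V)) 0 0`) from the PRIMITIVE data of pp. 15–16:
  separate holomorphy in (σ, τ) (`hΨσ hΨτ`), `A(σ)` symmetric with `Re A(σ) ≻ 0` (`hAs hA`), `Γ(σ)` linear with kernel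
  `G(σ)` (`hlin`), the (2.22) shape (`h222`), Lemma 2's (2.20) shape (`h220R`), ≤ m bonds per torus site
  (`hfibΛ hfibN`), the UNIFORM LOCALISATION of the primitive kernels `G(σ)`, `Γ₀`, `A(σ)⁻¹ = C^{(k)}(Z₀,σ)`, `C`
  (`hG hΓ₀ hCs hC216`, «L17a») and the (2.16)-type bounds of their σ-DIFFERENCES (`hdΓ hdC hdE`, «L16a»), norm bounds
  (`hc hΓq`), smallness numerics, and the two constant matchings `hPa : a ≤ γ₂ r_P²`, `hvol`.
  CONSEQUENCE FOR (D4): given the step objects, what separates the tree from the socket is EXACTLY {termwise domination (2.9)∕(2.14) for Bałaban's H — an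
  identification, cf. `B13Representation214.H28_sum_eq_sum_term214`} ∪ {L17a, L16a for Bałaban's k-th step kernels on
  the torus, UNIFORMLY in k on the box — printed support [13] = `B9.Thm315Printed` ff., with the G₂-perturbation
  step `pub-balaban/GAPS.md` G-B9-10 OPEN-IN-PRINT and k-uniformity asserted, not proved ([13] Sect. A)} ∪ {Lemma 2
  (2.20), (2.22), analyticity, norms: LOCATED-ROUTINE given the objects} ∪ {numbers}.
* RG BOOKKEEPING (why ONE numerics bundle per box suffices): the weight's |P|-rate is `a`, print's a = γ₂ε₁²∕g_k²
  varies with (k, p); `Termwise226`∕`weight` are ANTITONE in `a` (`weight_anti`, `termwise226_anti`), so every term bound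
  at the natural a(k,p) ≥ a_min := γ₂ε₁²∕γ₀² (p ∈ HistBox γ₀ k) implies the bound at a_min, and the 25 restrictions are
  checked ONCE at a_min — hence γ₀ = γ₀(ε₁) (the «γ₀ small given ε₁» reading of `Beta.RemainderResidue`).  Lemma 3's joiner is
  k-BLIND: k enters only through the objects `W₂` and through `a`.
* MODULUS NOTE: the (D4) leaf indexes sites by `TPt d (N n * M_D4)`; for `W n := (W₂ n).toTorusStep` one has
  N n = N′ n (LM-cubes per direction) and M_D4 = L·M ([II]'s M = sites per M-cube); `Bound238With` does not mention M.

Sources: [II] = T. Bałaban, CMP 116 (1988) 1–22, Lemma 3 (2.38) p. 20, (2.14)–(2.26) pp. 15–17 [Balaban1988RG2Cluster];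
[13] (reference list of [Balaban1987RG1], = cell paper B9) = T. Bałaban, CMP 99 (1985) 389–434, Thm 3.15
[Balaban1985BackgroundPropagators] (the tree's `B9.Thm315Printed`).  Cell record: pub-balaban-gaps `g1/G1-PLAN-D4.md` v1.4 §4b.
-/

namespace Literature.MathematicalPhysics.QuantumFieldTheory.Balaban1983to89.B13Lemma3TorusSocket

open Literature.MathematicalPhysics.QuantumFieldTheory.Balaban1983to89
open Literature.MathematicalPhysics.QuantumFieldTheory.Balaban1983to89.TreeLengthTorus
open Literature.MathematicalPhysics.QuantumFieldTheory.Balaban1983to89.TreeLengthTorusGeometry (TorusStep)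
open Literature.MathematicalPhysics.QuantumFieldTheory.Balaban1983to89.TreeLengthTorusTransfer (tclosure tclosureDom)
open Literature.MathematicalPhysics.QuantumFieldTheory.Balaban1983to89.TreeLengthTorusGeometry236Printed
  (ineq236Printed_torus)
open Literature.MathematicalPhysics.QuantumFieldTheory.Balaban1983to89.B12TreeDecay (kappa₀ K₀)
open Literature.MathematicalPhysics.QuantumFieldTheory.Balaban1983to89.B13Lemma3TorusData
open Literature.MathematicalPhysics.QuantumFieldTheory.Balaban1983to89.B13Lemma3Assembly (innerSum compSum famSum)
open Literature.MathematicalPhysics.QuantumFieldTheory.Balaban1983to89.B13Lemma3Torus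
  (J I cc wZ TwoTorusStep bound238With_torus)
open Literature.MathematicalPhysics.QuantumFieldTheory.Balaban1983to89.B13Lemma3TorusTerms
  (terms weight hrep_of_termwise)

noncomputable section

variable {L : ℕ} [NeZero L]

/-! ## §1. LEVEL R — the resummed (2.26)-majorant bound `HRep` (hypothesis `hrep` of `bound238With_torus`), named -/

section LevelR

variable {N' : ℕ} [NeZero N']

open Classical in
/-- **`HRep c M a a₅ W`** — the analytic input of [II] Lemma 3 in RESUMMED form, for ONE two-torus step `W` (d = 4):
on the space of p. 15, `‖H(Z)φ‖ ≤ e^{a₅|Z|}·Σ_{Z′₀ ⊆ Z} e^{−(κ₁−1)|Z∖Z′₀|}·Π_{components} famSum Π compSum Π innerSum`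
with the (2.26)-weights at |P|-rate `a` — VERBATIM the hypothesis `hrep` of `B13Lemma3Torus.bound238With_torus`
(LIT `B13Lemma3Torus.lean` :333).  A named hypothesis, not a claim. [cite: Balaban1988RG2Cluster, (2.26) p.17 and p.17–20 (resummation)] -/
def HRep (c : B13.Consts) (M : ℕ) [NeZero M] (a a₅ : ℝ) (W : TwoTorusStep 4 L N') : Prop :=
  ∀ (Z : TDom 4 N') (φ : W.Φ), φ ∈ W.sp2 Z → ‖W.H Z φ‖ ≤
    Real.exp (a₅ * ((Z.1).card : ℝ)) *
    ∑ j : J Z, Real.exp (-((c.κ₁ - 1) * ((wZ Z j).card : ℝ))) *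
      ∏ i : I Z j, famSum (B13FamilySum.coveringFamilies (Finset.univ : Finset (TDom 4 N'))
          (fun Z' : TDom 4 N' => Z'.1) (cc Z j i))
        (fun Z' => compSum (Finset.univ.filter fun Zc : TDom 4 (L * N') => tclosureDom L N' Zc = Z')
          (fun Zc => innerSum (Finset.univ : Finset (TDom 4 (L * N'))) (fun Y : TDom 4 (L * N') => Y.1)
            (tsys 4 (L * N')).dj Zc.1 (ttouch M (L * N')) (tavail M (L * N') Zc)
            (c.α₆ * c.eps2) ((1 - 3 * c.δ) * c.κ) a))

end LevelR

/-! ## §2. The printed restrictions on the constants, bundled ONCE (n- and k-uniform) -/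

/-- **`Lemma3Numerics c M ℓ a a₂ a₂' a₅ Aabs`** — the 25 numerical restrictions of `B13Lemma3Torus.bound238With_torus`
(signs; R15; R16 as `18(1−4δ)κ ≤ a/20` and `4κ ≤ a/20`; R17; (2.31); the (2.29)/(1.26) thresholds at the rates δκ and
δℓκ; `64e^{−a/20} ≤ δκ`; R18 half∕sharp; R20; R21; the absorption into C₃ε₁), bundled.  They mention neither the torus
size N′ nor the scale k: ONE witness serves every n and — at a := a_min of the box (§5) — every (k, p).  Non-vacuity
of this exact list (at L = 8, explicit constants): `B13Lemma3TorusNonvacuity.numerics_nonvacuous`. [cite: Balaban1988RG2Cluster, pp.17–20 (restrictions on the constants) and Lemma 3 p.20] -/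
structure Lemma3Numerics (c : B13.Consts) (M : ℕ) (ℓ a a₂ a₂' a₅ Aabs : ℝ) : Prop where
  hℓ : 0 ≤ ℓ
  hα₆ : 0 < c.α₆
  hε₀ : 0 ≤ c.eps2
  hδ : 0 ≤ c.δ
  hδ7 : 0 ≤ 1 - 7 * c.δ
  hκ : 0 ≤ c.κ
  ha : 0 ≤ a
  hR15 : c.R15
  hR16 : 18 * ((1 - 4 * c.δ) * c.κ) ≤ a / 20
  hR16' : 4 * c.κ ≤ a / 20
  hR17 : Real.exp (-(a / 20)) ≤ c.eps2
  h231 : 2 * (4 : ℝ) * (M : ℝ) ^ 4 * Real.exp (-(a / 10)) ≤ a / 20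
  ha₂ : 0 ≤ a₂
  hκ229 : kappa₀ 64 8 + a₂ ≤ c.δ * c.κ
  hsm229 : c.α₆ * Real.exp a₂ * K₀ 64 8 * 64 ≤ a₂
  habsk : Real.exp (-(a / 20)) * 64 ≤ c.δ * c.κ
  h18half : B13Step237.R18half c (K₀ 64 8 * Real.exp (Real.exp (-(a / 20)) * 64))
  h18 : B13Step237.R18sharp c (K₀ 64 8 * Real.exp (Real.exp (-(a / 20)) * 64)) ℓ
  ha₂' : 0 ≤ a₂'
  hκ229' : kappa₀ 64 8 + a₂' ≤ c.δ * ℓ * c.κ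
  hsm229' : c.α₆ * Real.exp a₂' * K₀ 64 8 * 64 ≤ a₂'
  hR20 : 18 * ((1 - 7 * c.δ) * ℓ * c.κ) ≤ (c.κ₁ - 1) / 2
  ha₅ : 0 ≤ a₅
  habs : a₅ + Real.exp (-((c.κ₁ - 1) / 2)) ≤ Aabs
  hAc : Aabs * 64 ≤ c.δ * ℓ * c.κ
  hC3 : B13Step237.bracketF c (K₀ 64 8 * Real.exp (Real.exp (-(a / 20)) * 64)) / c.α₆ *
    Real.exp (Aabs * 64) ≤ c.C3act * c.ε₁

/-! ## §3. LEVEL R joins: `HRep` ⟹ the socket field `h238` -/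

section JoinR

variable {N' : ℕ} [NeZero N']

/-- ONE TORUS: `HRep` + (2.36)_ℓ + the numerics ⟹ (2.38)_ℓ `B13.Bound238With W.toStepData c ℓ` — a re-packaging of
`B13Lemma3Torus.bound238With_torus` (every resummation, geometric and combinatorial step of pp. 17–20 is kernel-checked
there). [cite: Balaban1988RG2Cluster, Lemma 3 (2.38) p.20] -/
theorem bound238With_of_hRep (c : B13.Consts) (hLc : c.L = L) (W : TwoTorusStep 4 L N') (M : ℕ) [NeZero M]
    {ℓ a a₂ a₂' a₅ Aabs : ℝ} (hN : Lemma3Numerics c M ℓ a a₂ a₂' a₅ Aabs)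
    (h236 : B13.Ineq236With (tsys 4 (L * N')) (tsys 4 N') (tclosureDom L N') ℓ) (hrep : HRep c M a a₅ W) :
    B13.Bound238With W.toStepData c ℓ :=
  bound238With_torus c hLc W M hrep h236 hN.hℓ hN.hα₆ hN.hε₀ hN.hδ hN.hδ7 hN.hκ hN.ha hN.hR15 hN.hR16 hN.hR16'
    hN.hR17 hN.h231 hN.ha₂ hN.hκ229 hN.hsm229 hN.habsk hN.h18half hN.h18 hN.ha₂' hN.hκ229' hN.hsm229' hN.hR20 hN.ha₅
    hN.habs hN.hAc hN.hC3

end JoinR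

section Family

variable {N' : ℕ → ℕ} [∀ n, NeZero (N' n)]

/-- **THE SOCKET FIELD, LEVEL R.**  For a torus FAMILY of two-torus steps `W₂ n : TwoTorusStep 4 L (N′ n)` (the (D4)
leaf's `N`, `W n := (W₂ n).toTorusStep`): `HRep` at every n + (2.36)_ℓ at every size + ONE numerics bundle ⟹
`∀ n, B13.Bound238With ((W₂ n).toTorusStep).toStepData c ℓ` — literally the type of
`Beta.RemainderLocalityHolo.PolLeavesTFac190H.h238` for that `W` (`TwoTorusStep.toStepData` is the `abbrev`
`W.toTorusStep.toStepData`; see `socket_iff`). [cite: Balaban1988RG2Cluster, Lemma 3 (2.38) p.20] -/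
theorem h238_of_hRep (c : B13.Consts) (hLc : c.L = L) (W₂ : (n : ℕ) → TwoTorusStep 4 L (N' n)) (M : ℕ) [NeZero M]
    {ℓ a a₂ a₂' a₅ Aabs : ℝ} (hN : Lemma3Numerics c M ℓ a a₂ a₂' a₅ Aabs)
    (h236 : ∀ n, B13.Ineq236With (tsys 4 (L * N' n)) (tsys 4 (N' n)) (tclosureDom L (N' n)) ℓ)
    (hrep : ∀ n, HRep c M a a₅ (W₂ n)) :
    ∀ n, B13.Bound238With ((W₂ n).toTorusStep).toStepData c ℓ :=
  fun n => bound238With_of_hRep c hLc (W₂ n) M hN (h236 n) (hrep n)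

/-- The conclusion of `h238_of_hRep` IS the (D4) leaf's field type `∀ n, B13.Bound238With (W n).toStepData c ℓ` at
`W := fun n => (W₂ n).toTorusStep`, definitionally (the printed (2.38) socket read at the torus-step family; bookkeeping,
`Iff.rfl`). [cite: Balaban1988RG2Cluster, Lemma 3 (2.38) p.20] -/
theorem socket_iff (c : B13.Consts) (W₂ : (n : ℕ) → TwoTorusStep 4 L (N' n)) (ℓ : ℝ) :
    (∀ n, B13.Bound238With ((fun m => (W₂ m).toTorusStep) n).toStepData c ℓ) ↔
      ∀ n, B13.Bound238With (W₂ n).toStepData c ℓ :=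
  Iff.rfl

/-- **At the PRINTED transfer factor ℓ = ½L (L ≥ 8)** the (2.36) hypothesis is the tree theorem
`TreeLengthTorusGeometry236Printed.ineq236Printed_torus` at every torus size, so the socket field follows from `HRep`
and the numerics ALONE; `B13.Bound238With … (c.L/2)` ⟺ (2.38) verbatim by `B13.bound238With_half`. [cite: Balaban1988RG2Cluster, (2.36) p.19 and Lemma 3 (2.38) p.20] -/
theorem h238_of_hRep_half (c : B13.Consts) (hL : 8 ≤ c.L) (hLc : c.L = L) (W₂ : (n : ℕ) → TwoTorusStep 4 L (N' n))
    (M : ℕ) [NeZero M] {a a₂ a₂' a₅ Aabs : ℝ} (hN : Lemma3Numerics c M ((c.L : ℝ) / 2) a a₂ a₂' a₅ Aabs)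
    (hrep : ∀ n, HRep c M a a₅ (W₂ n)) :
    ∀ n, B13.Bound238With ((W₂ n).toTorusStep).toStepData c ((c.L : ℝ) / 2) := by
  subst hLc
  refine h238_of_hRep c rfl W₂ M hN (fun n => ?_) hrep
  exact ineq236Printed_torus (d := 4) c.L (N' n) hL

end Family

/-! ## §4. LEVEL T — (2.26) PER TERM (`hH`, `h226` of `hrep_of_termwise`), named, and its joins -/

section LevelT

variable {N' : ℕ} [NeZero N'] {M : ℕ} [NeZero M]

open Classical in
/-- **`TermDomination M W T`** — on the space of p. 15 the activity is dominated by its terms (𝐃, P):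
`‖H(Z)φ‖ ≤ Σ_{t ∈ terms L M Z} ‖T Z t φ‖` (e.g. `H(Z) = Σ_t T_t`, (2.9)/(2.14) pp. 14–15; for typed objects the
(𝐃, P)-summand IS the display (2.14): `B13Representation214.H28_sum_eq_sum_term214`).  Hypothesis `hH` of
`B13Lemma3TorusTerms.hrep_of_termwise`, named. [cite: Balaban1988RG2Cluster, (2.9) p.14 and (2.14) p.15] -/
def TermDomination (M : ℕ) [NeZero M] (W : TwoTorusStep 4 L N')
    (T : (Z : TDom 4 N') → Finset (TDom 4 (L * N')) × Finset (TBond 4 M (L * N')) → W.Φ → ℂ) : Prop :=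
  ∀ (Z : TDom 4 N') (φ : W.Φ), φ ∈ W.sp2 Z → ‖W.H Z φ‖ ≤ ∑ t ∈ terms L M Z, ‖T Z t φ‖

open Classical in
/-- **`Termwise226 c a a₅ W T`** — (2.26) p. 17 FOR EVERY TERM: `‖T_t(Z)φ‖ ≤ weight(t)·e^{a₅|Z|}` with
`B13Lemma3TorusTerms.weight` = e^{−(κ₁−1)|Z∖Z′₀|}·Π_{Y∈𝐃} α₆ε₂e^{−(1−3δ)κd_k(Y)}·e^{−(a/2)|P|}.  Hypothesis `h226` of
`hrep_of_termwise`, named; supplied per term from the primitive data by `B13Lemma3TorusPrimitive.h226_torus_of_primitives`.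
[cite: Balaban1988RG2Cluster, (2.26) p.17] -/
def Termwise226 (c : B13.Consts) (a a₅ : ℝ) (W : TwoTorusStep 4 L N')
    (T : (Z : TDom 4 N') → Finset (TDom 4 (L * N')) × Finset (TBond 4 M (L * N')) → W.Φ → ℂ) : Prop :=
  ∀ (Z : TDom 4 N') (φ : W.Φ), φ ∈ W.sp2 Z → ∀ t ∈ terms L M Z,
    ‖T Z t φ‖ ≤ weight L M c Z a t * Real.exp (a₅ * ((Z.1).card : ℝ))

/-- LEVEL T ⟹ LEVEL R: termwise domination + (2.26) per term ⟹ `HRep` — `B13Lemma3TorusTerms.hrep_of_termwise`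
(the printed resummation order p. 17 realized as an injection of the term set into the majorant's index sets).
[cite: Balaban1988RG2Cluster, (2.26) p.17 and p.17 (resummation order)] -/
theorem hRep_of_termwise (c : B13.Consts) {a a₅ : ℝ} (hA : 0 ≤ c.α₆ * c.eps2) (W : TwoTorusStep 4 L N')
    (T : (Z : TDom 4 N') → Finset (TDom 4 (L * N')) × Finset (TBond 4 M (L * N')) → W.Φ → ℂ)
    (hH : TermDomination M W T) (h226 : Termwise226 c a a₅ W T) : HRep c M a a₅ W :=
  hrep_of_termwise c hA W T hH h226

end LevelT

section FamilyT

variable {N' : ℕ → ℕ} [∀ n, NeZero (N' n)] {M : ℕ} [NeZero M]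

/-- **THE SOCKET FIELD, LEVEL T.**  For a torus family of two-torus steps with term maps `T n`: termwise domination +
(2.26) per term at every n + (2.36)_ℓ + ONE numerics bundle ⟹ `∀ n, B13.Bound238With ((W₂ n).toTorusStep).toStepData c ℓ`.
[cite: Balaban1988RG2Cluster, (2.26) p.17 and Lemma 3 (2.38) p.20] -/
theorem h238_of_termwise (c : B13.Consts) (hLc : c.L = L) (W₂ : (n : ℕ) → TwoTorusStep 4 L (N' n))
    (T : (n : ℕ) → (Z : TDom 4 (N' n)) → Finset (TDom 4 (L * N' n)) × Finset (TBond 4 M (L * N' n)) → (W₂ n).Φ → ℂ)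
    {ℓ a a₂ a₂' a₅ Aabs : ℝ} (hN : Lemma3Numerics c M ℓ a a₂ a₂' a₅ Aabs)
    (h236 : ∀ n, B13.Ineq236With (tsys 4 (L * N' n)) (tsys 4 (N' n)) (tclosureDom L (N' n)) ℓ)
    (hH : ∀ n, TermDomination M (W₂ n) (T n)) (h226 : ∀ n, Termwise226 c a a₅ (W₂ n) (T n)) :
    ∀ n, B13.Bound238With ((W₂ n).toTorusStep).toStepData c ℓ :=
  h238_of_hRep c hLc W₂ M hN h236 fun n =>
    hRep_of_termwise c (mul_nonneg hN.hα₆.le hN.hε₀) (W₂ n) (T n) (hH n) (h226 n)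

/-- … and at the printed ℓ = ½L (L ≥ 8), with (2.36) discharged by the tree. [cite: Balaban1988RG2Cluster, (2.36) p.19 and Lemma 3 (2.38) p.20] -/
theorem h238_of_termwise_half (c : B13.Consts) (hL : 8 ≤ c.L) (hLc : c.L = L)
    (W₂ : (n : ℕ) → TwoTorusStep 4 L (N' n))
    (T : (n : ℕ) → (Z : TDom 4 (N' n)) → Finset (TDom 4 (L * N' n)) × Finset (TBond 4 M (L * N' n)) → (W₂ n).Φ → ℂ)
    {a a₂ a₂' a₅ Aabs : ℝ} (hN : Lemma3Numerics c M ((c.L : ℝ) / 2) a a₂ a₂' a₅ Aabs)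
    (hH : ∀ n, TermDomination M (W₂ n) (T n)) (h226 : ∀ n, Termwise226 c a a₅ (W₂ n) (T n)) :
    ∀ n, B13.Bound238With ((W₂ n).toTorusStep).toStepData c ((c.L : ℝ) / 2) :=
  h238_of_hRep_half c hL hLc W₂ M hN fun n =>
    hRep_of_termwise c (mul_nonneg hN.hα₆.le hN.hε₀) (W₂ n) (T n) (hH n) (h226 n)

end FamilyT

/-! ## §5. RG bookkeeping: the |P|-rate `a` — antitonicity, hence ONE rate a_min per box -/

section Rate

variable {N' : ℕ} [NeZero N'] {M : ℕ} [NeZero M]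

omit [NeZero M] in
/-- The (2.26)-weight is ANTITONE in the |P|-rate: a ≤ a′ ⟹ weight(a′) ≤ weight(a) (the factor e^{−(a/2)|P|}).
[cite: Balaban1988RG2Cluster, (2.26) p.17] (elementary) -/
theorem weight_anti (c : B13.Consts) (hA : 0 ≤ c.α₆ * c.eps2) (Z : TDom 4 N') {a a' : ℝ} (h : a ≤ a')
    (t : Finset (TDom 4 (L * N')) × Finset (TBond 4 M (L * N'))) :
    weight L M c Z a' t ≤ weight L M c Z a t := by
  unfold weight
  refine mul_le_mul_of_nonneg_left ?_ (Real.exp_nonneg _)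
  refine mul_le_mul_of_nonneg_left ?_ ?_
  · have hP : (0 : ℝ) ≤ (t.2.card : ℝ) := Nat.cast_nonneg _
    exact Real.exp_le_exp.2 (by nlinarith)
  · exact Finset.prod_nonneg fun _ _ => mul_nonneg hA (Real.exp_nonneg _)

/-- Hence (2.26)-per-term at a LARGER rate a′ (print: a′ = γ₂ε₁²/g_k(p)², the natural rate at (k, p)) implies it at any
smaller rate a (the box minimum a_min = γ₂ε₁²/γ₀² on `HistBox γ₀ k`), so `Lemma3Numerics` is checked once, at a_min —
the k-uniformity of Lemma 3's constants reduced to γ₀ = γ₀(ε₁). [cite: Balaban1988RG2Cluster, (2.26) p.17 and p.20 (restrictions)] (bookkeeping) -/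
theorem termwise226_anti (c : B13.Consts) (hA : 0 ≤ c.α₆ * c.eps2) {a a' a₅ : ℝ} (h : a ≤ a')
    (W : TwoTorusStep 4 L N')
    (T : (Z : TDom 4 N') → Finset (TDom 4 (L * N')) × Finset (TBond 4 M (L * N')) → W.Φ → ℂ)
    (h226 : Termwise226 c a' a₅ W T) : Termwise226 c a a₅ W T :=
  fun Z φ hφ t ht => (h226 Z φ hφ t ht).trans
    (mul_le_mul_of_nonneg_right (weight_anti c hA Z h t) (Real.exp_nonneg _))

end Rate

end

end Literature.MathematicalPhysics.QuantumFieldTheory.Balaban1983to89.B13Lemma3TorusSocket
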